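import Literature.NumberTheory.EllipticCurves.OrdinaryLocalCondition
import Literature.NumberTheory.EllipticCurves.GlobalMinimalModel
import Literature.NumberTheory.EllipticCurves.BSDConductor
import Literature.NumberTheory.EllipticCurves.HeegnerPointsKolyvaginEulerSystem
import Mathlib.Algebra.Module.ZMod
import HarnessLib

/-!
# Route `KolyvaginRoadThree`, deciding crux `ZhangSharpFrameAtThreeHL` (item stmt-BirchSwinnertonDyer-19574):
# the PINNED DATA of the METHOD skeleton `Method2` as an importable module (definitions)
# (cell `bsd-stepL`, seat `bsd-stepL-zhang3-p1` g5; `--supports stmt-BirchSwinnertonDyer-19574`; kind definition)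

WHY THIS FILE. The registered METHOD skeleton of crux 19574 (koly g11 `Lines-method2-19574.lean`, planner copy
`plan/KOLYv2/Lines-method2r-19574.lean`, repaired copy `zhang3/skel/Lines-method2s-19574.lean`) states its stubs
`stub_levelRaisingAtThree` ∕ `stub_kolyvaginClassesAtThree` in terms of objects it DEFINES LOCALLY (§1 there:
`V3`, `IsUAdmissiblePrime`, `sgn`, `levelSelmerSubgroup`, `SelQ`, `SelRelQ`, `baseLocusQ`). A skeleton file is not
a tree module, so no `Theorems/` file can prove a stub BY NAME + SIGNATURE unless those objects live in an importable
module with the same meaning. This file is that module: the §1 definitions VERBATIM (bodies unchanged), over the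
landed Literature definition `WeierstrassCurve.ordinaryLocalKer` (koly g11, `OrdinaryLocalCondition.lean`,
p450980) instead of the skeleton's §0 local copies, with the base locus in W. Zhang's printed form (Definition 8.3:
localisation ZERO — repair (R2) of `zhang3/STUB-MISSTATED-19574-method2.md`), plus the one structural lemma the
composition uses ((A4) RELAXATION, `relaxation_le`, koly's proof verbatim). The skeleton then imports this file and
keeps only the stubs and `_of`; stub provers import it too.

HONEST FRAMING. Definitions and one monotonicity lemma; nothing about Heegner points, level raising or the crux is
asserted; no named fact; no `sorry`; no instance is declared (the `ZMod 3`-structure of `H¹(K, E[3])` enters the two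
`…Q` definitions as an instance BINDER, discharged by `AddCommGroup.zmodModule` + `zsmul_discreteH1_torsion` at the
call site, exactly as in the skeleton's `_of`). PARTITION: O2@3 (B10) × A1 × crux 19574 — none (typed vocabulary;
types the objects of the method skeleton, closes nothing; T7).

## The objects (W. Zhang, Camb. J. Math. 2 (2014), §§4–5, §8; at p = 3: koly MEMO-v1–v3)

* `V3 W K` = `H¹(K, E[3])` (tree `galH1Torsion (W.baseChange K) 3`), the ambient space of all Kolyvagin classes.
* `IsUAdmissiblePrime W K q` — UNIPOTENT-admissible primes at `p = 3` (koly MEMO-v1 §4: `q` prime, `q ∤ N`, `q ∤ d_K`,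
  `q ≠ 3`, `(q)` inert in `K`, `q ≡ 1 (mod 3)`, `3 ∤ a_q`), the substitute for Bertolini–Darmon admissible primes
  (which do not exist at `p = 3`: `3 ∣ q² − 1`).
* `levelSelmerSubgroup W K c n S μ` — the canonical LEVEL-RAISED eigen-Selmer space `Sel_n^μ ⊂ H¹(K, E[3])` relaxed
  at `S` (Zhang's `Sel_{𝔭_n}(A_n/K)^μ ⊗ k`, DEFINED WITHOUT the abelian variety `A_n`): the `μ`-eigenclasses of the
  complex conjugation `c` that satisfy E's Kummer condition (`selmerLocalKer`) at every infinite place and at every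
  finite place above no prime of `n ∪ S`, and the ORDINARY condition (`ordinaryLocalKer`: represented by a cocycle
  valued in `E[3]^{Γ_{K_v}}`, the toric line at a unipotent-admissible prime) at the places above `q ∈ n ∖ S`.
* `SelQ` ∕ `SelRelQ` — the same as `ZMod 3`-subspaces, indexed by finite sets of u-admissible primes.
* `baseLocusQ κ n` — the BASE LOCUS of a system of classes `κ · n` at level `n` (Zhang Def. 8.3 VERBATIM: the
  admissible `q` with `loc_q (κ m n) = 0` for all `m`, tree `torsionLocalKer`).

References: [cite: WZhang2014, §4.1, §5 (Sel_{𝔭_n}), Definition 8.3, (9.3)] [cite: BertoliniDarmon2005, §2.2–§2.3].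
-/

noncomputable section

open scoped Classical

namespace Summit.BirchSwinnertonDyer.Rank1Residual.X11b.Three.Koly.Method2

open WeierstrassCurve NumberField IsDedekindDomain
  Literature.NumberTheory.EllipticCurves Literature.NumberTheory.GaloisRepresentations Module

variable (W : WeierstrassCurve ℚ) (K : Type) [Field K] [NumberField K]

/-- **`H¹(K, E[3])`** — the ambient space of the crux's classes `d.kolyvaginClass Nat.prime_three 1` (tree
`galH1Torsion` of the base change `E/K` at the torsion level `3 = 3¹`). [cite: WZhang2014, §3.7 (3.21)] -/
abbrev V3 : Type := galH1Torsion (W.baseChange K) ((3 ^ 1 : ℕ) : ℤ)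

/-- **Unipotent-admissible primes at `p = 3`** (koly MEMO-v1 §4 ∕ MEMO-v2 Lemmas U1–U5; the `p = 3` substitute for
W. Zhang's admissible primes, Notations (xii), which require `p ∤ q² − 1`): `q` prime, `q ∤ N`, `q ∤ d_K`, `q ≠ 3`,
`(q)` prime in `𝓞_K` (inert), `q ≡ 1 (mod 3)`, `3 ∤ a_q` (so `Frob_q ≡ ±u (mod 3)` has trace `±2`; non-scalarity
of `u` is part of what the rank-lowering stub asks of the prime it produces). [cite: WZhang2014, Notations (xii)] -/
def IsUAdmissiblePrime [W.IsGloballyMinimal] (q : ℕ) : Prop :=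
  q.Prime ∧ ¬ q ∣ W.conductorNorm ℤ ∧ ¬ ((q : ℤ) ∣ NumberField.discr K) ∧ q ≠ 3 ∧
    (Ideal.span {(q : 𝓞 K)}).IsPrime ∧ q % 3 = 1 ∧ ¬ 3 ∣ (W.frobeniusTrace q).natAbs

/-- The sign attached to an eigenvalue index (`true ↦ +1`, `false ↦ −1`). [folklore] -/
def sgn (μ : Bool) : ℤ := if μ then 1 else -1

variable (c : K ≃ₐ[ℚ] K)

/-- **The canonical LEVEL-RAISED eigen-Selmer space `Sel_n^μ ⊂ H¹(K, E[3])`, relaxed at `S`** (W. Zhang 2014,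
`Sel_{𝔭_n}(A_n/K)^± ⊗ k`, defined WITHOUT `A_n`): the `μ`-eigenclasses of complex conjugation `c` satisfying E's
Kummer condition at every infinite place and at every finite place above no prime of `n ∪ S`, and the ORDINARY
condition (Literature `WeierstrassCurve.ordinaryLocalKer`) at the places above the primes of `n` not in `S`.
[cite: WZhang2014, §4.1 and §5 (Sel_{𝔭_n})] [cite: BertoliniDarmon2005, §2.3] -/
def levelSelmerSubgroup (n : Finset ℕ) (S : Set ℕ) (μ : Bool) : AddSubgroup (V3 W K) :=
  (conjAct W c ((3 ^ 1 : ℕ) : ℤ) - sgn μ • AddMonoidHom.id (V3 W K)).ker ⊓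
  ((⨅ (w : InfinitePlace K), selmerLocalKer (W.baseChange K) w.Completion ((3 ^ 1 : ℕ) : ℤ)) ⊓
  ((⨅ (v : HeightOneSpectrum (𝓞 K)) (_ : ∀ q ∈ (n : Set ℕ) ∪ S, (q : 𝓞 K) ∉ v.asIdeal),
      selmerLocalKer (W.baseChange K) (v.adicCompletion K) ((3 ^ 1 : ℕ) : ℤ)) ⊓
  (⨅ (q : ℕ) (_ : q ∈ n ∧ q ∉ S) (v : HeightOneSpectrum (𝓞 K)) (_ : (q : 𝓞 K) ∈ v.asIdeal),
      (W.baseChange K).ordinaryLocalKer (v.adicCompletion K) ((3 ^ 1 : ℕ) : ℤ))))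

variable [W.IsGloballyMinimal]

/-- `Sel_n^μ` as a `ZMod 3`-subspace of `H¹(K, E[3])` (for its unique `ZMod 3`-structure, supplied as an instance
binder), `n` a finite set of unipotent-admissible primes. [cite: WZhang2014, §5 (Sel_{𝔭_n})] -/
def SelQ [Module (ZMod 3) (V3 W K)] (n : Finset {q // IsUAdmissiblePrime W K q}) (μ : Bool) :
    Submodule (ZMod 3) (V3 W K) :=
  AddSubgroup.toZModSubmodule 3 (levelSelmerSubgroup W K c (n.image Subtype.val) ∅ μ)

/-- `Sel_n^μ` relaxed at the admissible primes in `S`, as a `ZMod 3`-subspace. [cite: WZhang2014, Lemma 8.4 (3)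
(relaxed Selmer group)] -/
def SelRelQ [Module (ZMod 3) (V3 W K)] (n : Finset {q // IsUAdmissiblePrime W K q})
    (S : Set {q // IsUAdmissiblePrime W K q}) (μ : Bool) : Submodule (ZMod 3) (V3 W K) :=
  AddSubgroup.toZModSubmodule 3 (levelSelmerSubgroup W K c (n.image Subtype.val) (Subtype.val '' S) μ)

/-- **The base locus of a system of classes at level `n`** (W. Zhang 2014, Definition 8.3, VERBATIM: *"ℓ is called
a base point of κ if ℓ does not divide D_K N p and we have loc_ℓ(c(n)) = 0 for all n ∈ Λ"*): the
unipotent-admissible primes `q` at whose place EVERY class `κ m n` has localisation ZERO in `H¹(K_q, E[3])`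
(tree `WeierstrassCurve.torsionLocalKer`). [cite: WZhang2014, Definition 8.3] -/
def baseLocusQ {M : Type} (κ : M → Finset {q // IsUAdmissiblePrime W K q} → V3 W K)
    (n : Finset {q // IsUAdmissiblePrime W K q}) : Set {q // IsUAdmissiblePrime W K q} :=
  {q | ∀ m, ∀ v : HeightOneSpectrum (𝓞 K), ((q : ℕ) : 𝓞 K) ∈ v.asIdeal →
    κ m n ∈ (W.baseChange K).torsionLocalKer (v.adicCompletion K) ((3 ^ 1 : ℕ) : ℤ)}

/-- **(A4) RELAXATION is definitional** (W. Zhang 2014, (9.3): *"the local condition from A₂ differs from that from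
A₁ only at the place q₂. We then have a trivial inclusion into the relaxed Selmer group"*): dropping the conditions
above `S ∋ q` can only enlarge the canonical space — unfolding `levelSelmerSubgroup` (Kummer condition on a SMALLER
set of places; ordinary condition on `n \ S ⊆ (n ∪ {q}) \ S`). Proof = koly g11's, verbatim. [cite: WZhang2014,
§9 (9.3)] -/
theorem relaxation_le [Module (ZMod 3) (V3 W K)]
    (n : Finset {q // IsUAdmissiblePrime W K q}) (q : {q // IsUAdmissiblePrime W K q})
    (S : Set {q // IsUAdmissiblePrime W K q}) (s : Bool) (hqn : q ∉ n) (hqS : q ∈ S) :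
    SelQ W K c n s ≤ SelRelQ W K c (insert q n) S s := by
  change AddSubgroup.toZModSubmodule 3 _ ≤ AddSubgroup.toZModSubmodule 3 _
  refine (OrderIso.le_iff_le _).mpr ?_
  unfold levelSelmerSubgroup
  refine inf_le_inf le_rfl (inf_le_inf le_rfl (inf_le_inf ?_ ?_))
  · -- the finite (Kummer) conditions: fewer places upstairs
    refine le_iInf fun v ↦ le_iInf fun hv ↦ iInf_le_of_le v (iInf_le _ fun q' hq' ↦ hv q' ?_)
    rcases hq' with hq' | hq'
    · left
      rw [Finset.mem_coe, Finset.mem_image] at hq' ⊢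
      obtain ⟨a, ha, rfl⟩ := hq'
      exact ⟨a, Finset.mem_insert_of_mem ha, rfl⟩
    · exact absurd hq' (Set.notMem_empty _)
  · -- the ordinary conditions: every q' ≠ q of (insert q n) \ S is in n
    refine le_iInf fun q' ↦ le_iInf fun hq' ↦ le_iInf fun v ↦ le_iInf fun hv ↦
      iInf_le_of_le q' (iInf_le_of_le ?_ (iInf_le_of_le v (iInf_le _ hv)))
    obtain ⟨hmem, hnot⟩ := hq'
    refine ⟨?_, Set.notMem_empty _⟩
    rw [Finset.mem_image] at hmem ⊢
    obtain ⟨a, ha, rfl⟩ := hmem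
    rcases Finset.mem_insert.mp ha with rfl | ha
    · exact absurd ⟨a, hqS, rfl⟩ hnot
    · exact ⟨a, ha, rfl⟩

/-- **Monotonicity of relaxation in `S`**: relaxing at more admissible primes can only enlarge the space
(`S ⊆ S'` ⟹ `SelRel n S ≤ SelRel n S'`); in particular `Sel n = SelRel n ∅ ≤ SelRel n S`. [folklore] -/
theorem selRelQ_mono [Module (ZMod 3) (V3 W K)]
    (n : Finset {q // IsUAdmissiblePrime W K q}) {S S' : Set {q // IsUAdmissiblePrime W K q}} (hSS' : S ⊆ S')
    (s : Bool) : SelRelQ W K c n S s ≤ SelRelQ W K c n S' s := by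
  change AddSubgroup.toZModSubmodule 3 _ ≤ AddSubgroup.toZModSubmodule 3 _
  refine (OrderIso.le_iff_le _).mpr ?_
  unfold levelSelmerSubgroup
  refine inf_le_inf le_rfl (inf_le_inf le_rfl (inf_le_inf ?_ ?_))
  · refine le_iInf fun v ↦ le_iInf fun hv ↦ iInf_le_of_le v (iInf_le _ fun q' hq' ↦ hv q' ?_)
    rcases hq' with hq' | hq'
    · exact Or.inl hq'
    · exact Or.inr (Set.image_mono hSS' hq')
  · refine le_iInf fun q' ↦ le_iInf fun hq' ↦ le_iInf fun v ↦ le_iInf fun hv ↦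
      iInf_le_of_le q' (iInf_le_of_le ?_ (iInf_le_of_le v (iInf_le _ hv)))
    exact ⟨hq'.1, fun h ↦ hq'.2 (Set.image_mono hSS' h)⟩

/-- `Sel_n^μ` is `Sel_n^μ` relaxed at nothing: `SelQ n = SelRelQ n ∅`. [folklore] -/
theorem selQ_eq_selRelQ_empty [Module (ZMod 3) (V3 W K)]
    (n : Finset {q // IsUAdmissiblePrime W K q}) (s : Bool) : SelQ W K c n s = SelRelQ W K c n ∅ s := by
  unfold SelQ SelRelQ
  rw [Set.image_empty]

/-! ## Good levels (koly g12, repair (R3) of `koly/STUB-MISSTATED-3-19574-scalar.md`)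

`IsUAdmissiblePrime` (trace `±2`, determinant `1` mod `3`) admits BOTH the non-scalar classes `±u` (`u ≠ 1` unipotent;
16 of the 18 determinant-one, non-zero-trace elements of `GL₂(𝔽₃)`) AND the two SCALAR classes `±1`. At a scalar prime
`q₀` the place `v ∣ q₀` of `K` has `Frob_v = Frob_{q₀}² = 1` on `E[3]`: `H¹(K_v, E[3])` is 4-dimensional, `H¹_fin` is
2-dimensional and `E[3]^{G_{K_v}} = E[3]`, so the ordinary condition `ordinaryLocalKer` is ALL of `H¹(K_v, E[3])` —
putting `q₀` into the level RELAXES the Selmer structure instead of imposing a transverse Lagrangian line, and the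
rank-lowering shape (A1) of the method skeleton is false at such levels (memo cited above: Poitou–Tate see-saw +
Čebotarev). The induction must therefore run on levels of NON-SCALAR primes only (`Frob_q² ≠ 1` on `E[3]`, i.e.
`Frob_v ≠ 1`: then `H¹(K_v, E[3]) = H¹_fin ⊕ H¹_ord` is a hyperbolic plane of two Lagrangian lines, the local picture of
every level-raising step); W. Zhang's admissible primes (`p ≥ 5`, `p ∤ q² − 1`) are automatically of this kind. The
predicate is phrased exactly like the tree's `FrobEqFrobInfty` (Gross 1991 (3.2)): through an arithmetic Frobenius at a
prime of `ℤ̄` above `q` acting on `geomTorsion W p` (independent of the choices, `ρ̄_{E,p}` being unramified at `q ∤ pN`). -/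

/-- **`Frob_q² ≠ 1` on `E[p]`** (for a unipotent-admissible `q` at `p = 3`: `ρ̄(Frob_q) = ±u` with `u ≠ 1`, i.e. the
residual Frobenius is NON-SCALAR; at the inert place `v ∣ q` of `K`: `E[p]^{G_{K_v}} ≠ E[p]`): some arithmetic Frobenius
`h ∈ Gal(ℚ̄/ℚ)` at some prime `𝔓` of `ℤ̄ = absIntegers (𝓞 ℚ) ℚ` above `q` (Mathlib `IsArithFrobAt`; the tree's
`primesAbove`) satisfies `h • (h • P) ≠ P` for some `P ∈ E[p] = geomTorsion E p`. [cite: WZhang2014, Notations (xii)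
(admissible primes: p ∤ q² − 1)] [cite: BertoliniDarmon2005, §2.2] -/
def FrobSqNeOneAt (E : WeierstrassCurve ℚ) (p q : ℕ) : Prop :=
  ∃ (v : HeightOneSpectrum (𝓞 ℚ)) (𝔓 : Ideal (absIntegers (𝓞 ℚ) ℚ)) (h : Field.absoluteGaloisGroup ℚ),
    (q : 𝓞 ℚ) ∈ v.asIdeal ∧ 𝔓 ∈ v.primesAbove ∧ IsArithFrobAt (𝓞 ℚ) h 𝔓 ∧
      ∃ P : geomTorsion E p, h • (h • P) ≠ P

/-- **GOOD levels of the method skeleton**: finite sets of unipotent-admissible primes ALL of whose residual Frobenii are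
non-scalar (`Frob_q² ≠ 1` on `E[3]`) — the levels at which every local condition of `levelSelmerSubgroup` is a
Lagrangian line and W. Zhang's induction (tree `ZhangInductionOn.exists_ne_zero_of_zhangInduction_on…`, relativised to a
predicate on levels) is run. [cite: WZhang2014, §9 proof of Thm. 9.1 (the levels N q₁ ⋯ q_i visited)] -/
def GoodLevel (n : Finset {q // IsUAdmissiblePrime W K q}) : Prop :=
  ∀ q ∈ n, FrobSqNeOneAt W 3 q.1

/-- The bottom level `∅` is good (vacuously). [folklore] -/
theorem goodLevel_empty : GoodLevel W K (∅ : Finset {q // IsUAdmissiblePrime W K q}) :=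
  fun q hq ↦ absurd hq (Finset.notMem_empty q)

/-- `insert q n` is good iff `q` is non-scalar and `n` is good. [folklore] -/
theorem goodLevel_insert_iff {n : Finset {q // IsUAdmissiblePrime W K q}} {q : {q // IsUAdmissiblePrime W K q}} :
    GoodLevel W K (insert q n) ↔ FrobSqNeOneAt W 3 q.1 ∧ GoodLevel W K n :=
  Finset.forall_mem_insert q n _

/-- A good level stays good after inserting a non-scalar prime. [folklore] -/
theorem GoodLevel.insert {n : Finset {q // IsUAdmissiblePrime W K q}} {q : {q // IsUAdmissiblePrime W K q}}
    (hn : GoodLevel W K n) (hq : FrobSqNeOneAt W 3 q.1) : GoodLevel W K (insert q n) :=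
  (goodLevel_insert_iff W K).mpr ⟨hq, hn⟩

/-- Sub-levels of good levels are good. [folklore] -/
theorem GoodLevel.mono {n n' : Finset {q // IsUAdmissiblePrime W K q}} (hn : GoodLevel W K n) (h : n' ⊆ n) :
    GoodLevel W K n' :=
  fun q hq ↦ hn q (h hq)

end Summit.BirchSwinnertonDyer.Rank1Residual.X11b.Three.Koly.Method2

end
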